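import Mathlib
import Summits.Ventures.PercRepro2.Defs
import Summits.Ventures.PercRepro2.Harris
import Summits.Ventures.PercRepro2.Graph
import Summits.Ventures.PercRepro2.Exploration
import Summits.Ventures.PercRepro2.Events
import Summits.Ventures.PercRepro2.CutVertexDefs
import Summits.Ventures.PercRepro2.CDCutVertex
import Summits.Ventures.PercRepro2.TCutVertex

/-!
# (T_h) across a cut vertex with a MIXED up-set «near ∨ far» (blind cell PercRepro2, mine-a g46;
MINE-A.md §101.5 (f))

Cut vertex `x` (`CutV.IsCut ends x VA VB EA EB`), root `s ∈ VA`, hit vertex `h ∈ VB`; the up-set `𝓤`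
is the UNION `𝓤_A ∪ 𝓤_B` of an up-set read on the root side (`S ∈ 𝓤_A ↔ S ∩ (VA ∪ {x}) ∈ 𝓤_A`) and an
up-set read beyond the cut (`S ∈ 𝓤_B ↔ S ∩ VB ∈ 𝓤_B`, `∅ ∉ 𝓤_B`); the up-set `𝓥` is read beyond the
cut.  Then `U = {C_A(s) ∈ 𝓤_A} ∪ ({s ↔ x in A} ∩ {C_x ∈ 𝓤_B in B})`, and inclusion–exclusion on this
union followed by the product law gives, with `ξ = P_{p_A}(s ↔ x)`, `α = P_{p_A}(s ↔ x, C_s ∈ 𝓤_A)`,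
`ν = P_{p_A}(C_s ∈ 𝓤_A)` and the far-side quantities under `p_B`,

  **`T(p; s, h; 𝓤_A ∪ 𝓤_B, 𝓥) = (α − ξν)·P_B(Q_B ∩ e_B) + (ξ − α)·[(1 − ξ)·P_B(Q_B ∩ U_B ∩ e_B) + ξ·T_B]`**

(`t_cut_or_identity`), where `T_B` is the (T)-form on the far side with root `x` and the up-sets
`𝓤_B`, `𝓥`, and `α − ξν = Cov_{p_A}({s ↔ x}, {C_s ∈ 𝓤_A}) ≥ 0` by Harris.  Hence (T_h) on the far side
gives (T_h) on `G` for this mixed up-set (`t_of_cut_or`); the case `𝓤_A = ∅` is `TCutVertex.t_of_cut`.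
Exact check in Fractions on 26 random glued multigraphs, 0 mismatches (data/mine-a/g46/codes).
No definition; one seat.
-/

namespace Summit.Ventures.PercRepro2

namespace TCutVertexOr

open CutV

variable {V : Type*} {E : Type*} [Fintype E] [DecidableEq E]
  {R : Type*} [Field R] [LinearOrder R] [IsStrictOrderedRing R]
variable {ends : E → Sym2 V} {x : V} {VA VB : Set V} {EA EB : Set E}
  [DecidablePred (· ∈ EA)] [DecidablePred (· ∈ EB)]

omit [Fintype E] [DecidableEq E] [Field R] [LinearOrder R] [IsStrictOrderedRing R]
  [DecidablePred (· ∈ EB)] in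
/-- A cluster event read on the root side is an `A`-side event. -/
lemma clusterInEvent_eq_side' (h : IsCut ends x VA VB EA EB) {s : V} (hs : s ∈ VA)
    {𝓥 : Set (Set V)} (h𝓥 : ∀ S, S ∈ 𝓥 ↔ S ∩ (VA ∪ {x}) ∈ 𝓥) :
    clusterInEvent ends s 𝓥 = sideEvent EA (clusterInEvent ends s 𝓥) := by
  ext ω
  simp only [mem_clusterInEvent, mem_sideEvent]
  rw [h𝓥 (cluster ends ω s), cluster_inter_eq h (Or.inl hs)]

omit [LinearOrder R] [IsStrictOrderedRing R] in
/-- `P({A-side event} ∩ {B-side event}) = P_{p_A}(·) · P_{p_B}(·)`. -/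
lemma prob_side_inter_side' (p : E → R) (h : IsCut ends x VA VB EA EB) (X Y : Set (Config E)) :
    prob p (sideEvent EA X ∩ sideEvent EB Y) =
      prob (fun e => if e ∈ EA then p e else 0) X * prob (fun e => if e ∈ EB then p e else 0) Y := by
  rw [prob_sideEvent_inter_eq_mul p h, CDCutVertex.prob_zeroOff_eq_prob_sideEvent p EA X,
    CDCutVertex.prob_zeroOff_eq_prob_sideEvent p EB Y]

omit [Fintype E] [DecidableEq E] [Field R] [LinearOrder R] [IsStrictOrderedRing R]
  [DecidablePred (· ∈ EA)] [DecidablePred (· ∈ EB)] in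
/-- The cluster event of a union of up-sets is the union of the cluster events. -/
lemma clusterInEvent_union (s : V) (𝓐 𝓑 : Set (Set V)) :
    clusterInEvent ends s (𝓐 ∪ 𝓑) = clusterInEvent ends s 𝓐 ∪ clusterInEvent ends s 𝓑 := by
  ext ω
  simp only [mem_clusterInEvent, Set.mem_union]

omit [LinearOrder R] [IsStrictOrderedRing R] in
/-- The probability of a union of two «A-side ∩ B-side» events, by inclusion–exclusion and the
product law. -/
lemma prob_union_of_sides (p : E → R) (h : IsCut ends x VA VB EA EB)
    (A₁ A₂ B₁ B₂ : Set (Config E)) :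
    prob p ((sideEvent EA A₁ ∩ sideEvent EB B₁) ∪ (sideEvent EA A₂ ∩ sideEvent EB B₂)) =
      prob (fun e => if e ∈ EA then p e else 0) A₁ * prob (fun e => if e ∈ EB then p e else 0) B₁ +
        prob (fun e => if e ∈ EA then p e else 0) A₂ * prob (fun e => if e ∈ EB then p e else 0) B₂ -
        prob (fun e => if e ∈ EA then p e else 0) (A₁ ∩ A₂) *
          prob (fun e => if e ∈ EB then p e else 0) (B₁ ∩ B₂) := by
  have hI : (sideEvent EA A₁ ∩ sideEvent EB B₁) ∩ (sideEvent EA A₂ ∩ sideEvent EB B₂) =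
      sideEvent EA (A₁ ∩ A₂) ∩ sideEvent EB (B₁ ∩ B₂) := by
    rw [TCutVertex.sideEvent_inter, TCutVertex.sideEvent_inter]
    ext ω; simp only [Set.mem_inter_iff]; tauto
  have hu := prob_union_add_prob_inter p (sideEvent EA A₁ ∩ sideEvent EB B₁)
    (sideEvent EA A₂ ∩ sideEvent EB B₂)
  rw [hI, prob_side_inter_side' p h, prob_side_inter_side' p h, prob_side_inter_side' p h] at hu
  linear_combination hu

omit [LinearOrder R] [IsStrictOrderedRing R] in
/-- **The (T)-form across the cut with the mixed up-set `𝓤_A ∪ 𝓤_B`.** -/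
theorem t_cut_or_identity (p : E → R) (h : IsCut ends x VA VB EA EB) {s hv : V} (hs : s ∈ VA)
    (hvB : hv ∈ VB) {𝓤A 𝓤B 𝓥 : Set (Set V)} (h𝓤A : ∀ S, S ∈ 𝓤A ↔ S ∩ (VA ∪ {x}) ∈ 𝓤A)
    (h𝓤B : ∀ S, S ∈ 𝓤B ↔ S ∩ VB ∈ 𝓤B) (h𝓤B0 : ∅ ∉ 𝓤B)
    (h𝓥 : ∀ S, S ∈ 𝓥 ↔ S ∩ VB ∈ 𝓥) (h𝓥0 : ∅ ∉ 𝓥) :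
    prob p (clusterInEvent ends s {T : Set V | hv ∈ T} ∩ clusterInEvent ends s (𝓤A ∪ 𝓤B) ∩
        clusterInEvent ends s 𝓥) +
      prob p (clusterInEvent ends s {T : Set V | hv ∈ T}) *
        prob p (clusterInEvent ends s (𝓤A ∪ 𝓤B) ∩ clusterInEvent ends s 𝓥) -
      prob p (clusterInEvent ends s {T : Set V | hv ∈ T} ∩ clusterInEvent ends s (𝓤A ∪ 𝓤B)) *
        prob p (clusterInEvent ends s 𝓥) -
      prob p (clusterInEvent ends s {T : Set V | hv ∈ T} ∩ clusterInEvent ends s 𝓥) *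
        prob p (clusterInEvent ends s (𝓤A ∪ 𝓤B)) =
    (prob (fun e => if e ∈ EA then p e else 0) (connEvent ends s x ∩ clusterInEvent ends s 𝓤A) -
        prob (fun e => if e ∈ EA then p e else 0) (connEvent ends s x) *
          prob (fun e => if e ∈ EA then p e else 0) (clusterInEvent ends s 𝓤A)) *
      prob (fun e => if e ∈ EB then p e else 0)
        (clusterInEvent ends x {T : Set V | hv ∈ T} ∩ clusterInEvent ends x 𝓥) +
    (prob (fun e => if e ∈ EA then p e else 0) (connEvent ends s x) -
        prob (fun e => if e ∈ EA then p e else 0) (connEvent ends s x ∩ clusterInEvent ends s 𝓤A)) *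
      ((1 - prob (fun e => if e ∈ EA then p e else 0) (connEvent ends s x)) *
          prob (fun e => if e ∈ EB then p e else 0)
            (clusterInEvent ends x {T : Set V | hv ∈ T} ∩ clusterInEvent ends x 𝓤B ∩
              clusterInEvent ends x 𝓥) +
        prob (fun e => if e ∈ EA then p e else 0) (connEvent ends s x) *
          (prob (fun e => if e ∈ EB then p e else 0)
              (clusterInEvent ends x {T : Set V | hv ∈ T} ∩ clusterInEvent ends x 𝓤B ∩
                clusterInEvent ends x 𝓥) +
            prob (fun e => if e ∈ EB then p e else 0) (clusterInEvent ends x {T : Set V | hv ∈ T}) *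
              prob (fun e => if e ∈ EB then p e else 0)
                (clusterInEvent ends x 𝓤B ∩ clusterInEvent ends x 𝓥) -
            prob (fun e => if e ∈ EB then p e else 0)
                (clusterInEvent ends x {T : Set V | hv ∈ T} ∩ clusterInEvent ends x 𝓤B) *
              prob (fun e => if e ∈ EB then p e else 0) (clusterInEvent ends x 𝓥) -
            prob (fun e => if e ∈ EB then p e else 0)
                (clusterInEvent ends x {T : Set V | hv ∈ T} ∩ clusterInEvent ends x 𝓥) *
              prob (fun e => if e ∈ EB then p e else 0) (clusterInEvent ends x 𝓤B))) := by
  -- membership characterisations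
  have mQ : ∀ ω, ω ∈ clusterInEvent ends s {T : Set V | hv ∈ T} ↔
      (restrict EA ω ∈ connEvent ends s x ∧
        restrict EB ω ∈ clusterInEvent ends x {T : Set V | hv ∈ T}) := fun ω => by
    rw [TCutVertex.hit_eq (EA := EA) h hs hvB]; exact Iff.rfl
  have mUB : ∀ ω, ω ∈ clusterInEvent ends s 𝓤B ↔
      (restrict EA ω ∈ connEvent ends s x ∧ restrict EB ω ∈ clusterInEvent ends x 𝓤B) := fun ω => by
    rw [TCutVertex.clusterInEvent_eq (EA := EA) h hs h𝓤B h𝓤B0]; exact Iff.rfl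
  have mE : ∀ ω, ω ∈ clusterInEvent ends s 𝓥 ↔
      (restrict EA ω ∈ connEvent ends s x ∧ restrict EB ω ∈ clusterInEvent ends x 𝓥) := fun ω => by
    rw [TCutVertex.clusterInEvent_eq (EA := EA) h hs h𝓥 h𝓥0]; exact Iff.rfl
  have mUA : ∀ ω, ω ∈ clusterInEvent ends s 𝓤A ↔ restrict EA ω ∈ clusterInEvent ends s 𝓤A := fun ω => by
    simp only [mem_clusterInEvent]
    rw [h𝓤A (cluster ends ω s), cluster_inter_eq h (Or.inl hs)]
  have mU : ∀ ω, ω ∈ clusterInEvent ends s (𝓤A ∪ 𝓤B) ↔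
      (restrict EA ω ∈ clusterInEvent ends s 𝓤A ∨
        (restrict EA ω ∈ connEvent ends s x ∧ restrict EB ω ∈ clusterInEvent ends x 𝓤B)) := fun ω => by
    rw [clusterInEvent_union, Set.mem_union, mUA ω, mUB ω]
  -- the seven events as unions / intersections of «A-side ∩ B-side» events
  have s1 : clusterInEvent ends s {T : Set V | hv ∈ T} ∩ clusterInEvent ends s (𝓤A ∪ 𝓤B) ∩
      clusterInEvent ends s 𝓥 =
      (sideEvent EA (connEvent ends s x ∩ clusterInEvent ends s 𝓤A) ∩
        sideEvent EB (clusterInEvent ends x {T : Set V | hv ∈ T} ∩ clusterInEvent ends x 𝓥)) ∪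
      (sideEvent EA (connEvent ends s x) ∩
        sideEvent EB (clusterInEvent ends x {T : Set V | hv ∈ T} ∩ clusterInEvent ends x 𝓤B ∩
          clusterInEvent ends x 𝓥)) := by
    ext ω
    simp only [Set.mem_inter_iff, Set.mem_union, mem_sideEvent]
    rw [mQ ω, mU ω, mE ω]; tauto
  have s2 : clusterInEvent ends s {T : Set V | hv ∈ T} =
      sideEvent EA (connEvent ends s x) ∩
        sideEvent EB (clusterInEvent ends x {T : Set V | hv ∈ T}) :=
    TCutVertex.hit_eq (EA := EA) h hs hvB
  have s3 : clusterInEvent ends s (𝓤A ∪ 𝓤B) ∩ clusterInEvent ends s 𝓥 =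
      (sideEvent EA (connEvent ends s x ∩ clusterInEvent ends s 𝓤A) ∩
        sideEvent EB (clusterInEvent ends x 𝓥)) ∪
      (sideEvent EA (connEvent ends s x) ∩
        sideEvent EB (clusterInEvent ends x 𝓤B ∩ clusterInEvent ends x 𝓥)) := by
    ext ω
    simp only [Set.mem_inter_iff, Set.mem_union, mem_sideEvent]
    rw [mU ω, mE ω]; tauto
  have s4 : clusterInEvent ends s {T : Set V | hv ∈ T} ∩ clusterInEvent ends s (𝓤A ∪ 𝓤B) =
      (sideEvent EA (connEvent ends s x ∩ clusterInEvent ends s 𝓤A) ∩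
        sideEvent EB (clusterInEvent ends x {T : Set V | hv ∈ T})) ∪
      (sideEvent EA (connEvent ends s x) ∩
        sideEvent EB (clusterInEvent ends x {T : Set V | hv ∈ T} ∩ clusterInEvent ends x 𝓤B)) := by
    ext ω
    simp only [Set.mem_inter_iff, Set.mem_union, mem_sideEvent]
    rw [mQ ω, mU ω]; tauto
  have s5 : clusterInEvent ends s 𝓥 =
      sideEvent EA (connEvent ends s x) ∩ sideEvent EB (clusterInEvent ends x 𝓥) :=
    TCutVertex.clusterInEvent_eq (EA := EA) h hs h𝓥 h𝓥0
  have s6 : clusterInEvent ends s {T : Set V | hv ∈ T} ∩ clusterInEvent ends s 𝓥 =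
      sideEvent EA (connEvent ends s x) ∩
        sideEvent EB (clusterInEvent ends x {T : Set V | hv ∈ T} ∩ clusterInEvent ends x 𝓥) := by
    ext ω
    simp only [Set.mem_inter_iff, mem_sideEvent]
    rw [mQ ω, mE ω]; tauto
  have s7 : clusterInEvent ends s (𝓤A ∪ 𝓤B) =
      (sideEvent EA (clusterInEvent ends s 𝓤A) ∩ sideEvent EB Set.univ) ∪
      (sideEvent EA (connEvent ends s x) ∩ sideEvent EB (clusterInEvent ends x 𝓤B)) := by
    ext ω
    simp only [Set.mem_inter_iff, Set.mem_union, mem_sideEvent, Set.mem_univ, and_true]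
    exact mU ω
  -- the intersections appearing in the inclusion–exclusion terms
  have iA1 : (connEvent ends s x ∩ clusterInEvent ends s 𝓤A) ∩ connEvent ends s x =
      connEvent ends s x ∩ clusterInEvent ends s 𝓤A := by
    ext ω; simp only [Set.mem_inter_iff]; tauto
  have iA2 : clusterInEvent ends s 𝓤A ∩ connEvent ends s x =
      connEvent ends s x ∩ clusterInEvent ends s 𝓤A := Set.inter_comm _ _
  have iB1 : (clusterInEvent ends x {T : Set V | hv ∈ T} ∩ clusterInEvent ends x 𝓥) ∩
      (clusterInEvent ends x {T : Set V | hv ∈ T} ∩ clusterInEvent ends x 𝓤B ∩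
        clusterInEvent ends x 𝓥) =
      clusterInEvent ends x {T : Set V | hv ∈ T} ∩ clusterInEvent ends x 𝓤B ∩
        clusterInEvent ends x 𝓥 := by
    ext ω; simp only [Set.mem_inter_iff]; tauto
  have iB3 : clusterInEvent ends x 𝓥 ∩ (clusterInEvent ends x 𝓤B ∩ clusterInEvent ends x 𝓥) =
      clusterInEvent ends x 𝓤B ∩ clusterInEvent ends x 𝓥 := by
    ext ω; simp only [Set.mem_inter_iff]; tauto
  have iB4 : clusterInEvent ends x {T : Set V | hv ∈ T} ∩
      (clusterInEvent ends x {T : Set V | hv ∈ T} ∩ clusterInEvent ends x 𝓤B) =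
      clusterInEvent ends x {T : Set V | hv ∈ T} ∩ clusterInEvent ends x 𝓤B := by
    ext ω; simp only [Set.mem_inter_iff]; tauto
  have iB7 : (Set.univ : Set (Config E)) ∩ clusterInEvent ends x 𝓤B = clusterInEvent ends x 𝓤B :=
    Set.univ_inter _
  -- the seven probabilities
  have p1 := congrArg (prob p) s1
  rw [prob_union_of_sides p h, iA1, iB1] at p1
  have p2 := congrArg (prob p) s2
  rw [prob_side_inter_side' p h] at p2
  have p3 := congrArg (prob p) s3
  rw [prob_union_of_sides p h, iA1, iB3] at p3
  have p4 := congrArg (prob p) s4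
  rw [prob_union_of_sides p h, iA1, iB4] at p4
  have p5 := congrArg (prob p) s5
  rw [prob_side_inter_side' p h] at p5
  have p6 := congrArg (prob p) s6
  rw [prob_side_inter_side' p h] at p6
  have p7 := congrArg (prob p) s7
  rw [prob_union_of_sides p h, iA2, iB7, prob_univ] at p7
  rw [p1, p4, p6, p2, p3, p5, p7]
  ring

/-- **(T_h) transfers across a cut vertex for the mixed up-set `𝓤_A ∪ 𝓤_B`** (`𝓤_A` read on the root
side, `𝓤_B` and `𝓥` beyond the cut): (T) on the far side with root `x` and the up-sets `𝓤_B`, `𝓥`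
implies (T_h) on `G`. -/
theorem t_of_cut_or (p : E → R) (hp : IsProbVec p) (h : IsCut ends x VA VB EA EB) {s hv : V}
    (hs : s ∈ VA) (hvB : hv ∈ VB) {𝓤A 𝓤B 𝓥 : Set (Set V)}
    (h𝓤A : ∀ S, S ∈ 𝓤A ↔ S ∩ (VA ∪ {x}) ∈ 𝓤A) (h𝓤Aup : IsUpperSet 𝓤A)
    (h𝓤B : ∀ S, S ∈ 𝓤B ↔ S ∩ VB ∈ 𝓤B) (h𝓤B0 : ∅ ∉ 𝓤B)
    (h𝓥 : ∀ S, S ∈ 𝓥 ↔ S ∩ VB ∈ 𝓥) (h𝓥0 : ∅ ∉ 𝓥)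
    (hB : prob (fun e => if e ∈ EB then p e else 0)
            (clusterInEvent ends x {T : Set V | hv ∈ T} ∩ clusterInEvent ends x 𝓤B) *
          prob (fun e => if e ∈ EB then p e else 0) (clusterInEvent ends x 𝓥) +
        prob (fun e => if e ∈ EB then p e else 0) (clusterInEvent ends x 𝓤B) *
          prob (fun e => if e ∈ EB then p e else 0)
            (clusterInEvent ends x {T : Set V | hv ∈ T} ∩ clusterInEvent ends x 𝓥) ≤
        prob (fun e => if e ∈ EB then p e else 0)
            (clusterInEvent ends x {T : Set V | hv ∈ T} ∩ clusterInEvent ends x 𝓤B ∩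
              clusterInEvent ends x 𝓥) +
          prob (fun e => if e ∈ EB then p e else 0) (clusterInEvent ends x {T : Set V | hv ∈ T}) *
            prob (fun e => if e ∈ EB then p e else 0)
              (clusterInEvent ends x 𝓤B ∩ clusterInEvent ends x 𝓥)) :
    prob p (clusterInEvent ends s {T : Set V | hv ∈ T} ∩ clusterInEvent ends s (𝓤A ∪ 𝓤B)) *
        prob p (clusterInEvent ends s 𝓥) +
      prob p (clusterInEvent ends s (𝓤A ∪ 𝓤B)) *
        prob p (clusterInEvent ends s {T : Set V | hv ∈ T} ∩ clusterInEvent ends s 𝓥) ≤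
      prob p (clusterInEvent ends s {T : Set V | hv ∈ T} ∩ clusterInEvent ends s (𝓤A ∪ 𝓤B) ∩
          clusterInEvent ends s 𝓥) +
        prob p (clusterInEvent ends s {T : Set V | hv ∈ T}) *
          prob p (clusterInEvent ends s (𝓤A ∪ 𝓤B) ∩ clusterInEvent ends s 𝓥) := by
  have hid := t_cut_or_identity p h hs hvB h𝓤A h𝓤B h𝓤B0 h𝓥 h𝓥0
  have hpA : IsProbVec (fun e => if e ∈ EA then p e else 0) := CDCutVertex.isProbVec_zeroOff hp EA
  have hpB : IsProbVec (fun e => if e ∈ EB then p e else 0) := CDCutVertex.isProbVec_zeroOff hp EB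
  have hcov : 0 ≤ prob (fun e => if e ∈ EA then p e else 0)
      (connEvent ends s x ∩ clusterInEvent ends s 𝓤A) -
      prob (fun e => if e ∈ EA then p e else 0) (connEvent ends s x) *
        prob (fun e => if e ∈ EA then p e else 0) (clusterInEvent ends s 𝓤A) :=
    sub_nonneg.2 (prob_mul_prob_le_prob_inter hpA (isUpperSet_connEvent ends s x)
      (isUpperSet_clusterInEvent ends s h𝓤Aup))
  have hqe : 0 ≤ prob (fun e => if e ∈ EB then p e else 0)
      (clusterInEvent ends x {T : Set V | hv ∈ T} ∩ clusterInEvent ends x 𝓥) := prob_nonneg hpB _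
  have hξα : 0 ≤ prob (fun e => if e ∈ EA then p e else 0) (connEvent ends s x) -
      prob (fun e => if e ∈ EA then p e else 0) (connEvent ends s x ∩ clusterInEvent ends s 𝓤A) :=
    sub_nonneg.2 (prob_inter_le_left hpA _ _)
  have hξ1 : 0 ≤ 1 - prob (fun e => if e ∈ EA then p e else 0) (connEvent ends s x) :=
    sub_nonneg.2 (prob_le_one hpA _)
  have hξ0 : 0 ≤ prob (fun e => if e ∈ EA then p e else 0) (connEvent ends s x) := prob_nonneg hpA _
  have hque : 0 ≤ prob (fun e => if e ∈ EB then p e else 0)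
      (clusterInEvent ends x {T : Set V | hv ∈ T} ∩ clusterInEvent ends x 𝓤B ∩
        clusterInEvent ends x 𝓥) := prob_nonneg hpB _
  have hTB : 0 ≤ prob (fun e => if e ∈ EB then p e else 0)
            (clusterInEvent ends x {T : Set V | hv ∈ T} ∩ clusterInEvent ends x 𝓤B ∩
              clusterInEvent ends x 𝓥) +
          prob (fun e => if e ∈ EB then p e else 0) (clusterInEvent ends x {T : Set V | hv ∈ T}) *
            prob (fun e => if e ∈ EB then p e else 0)
              (clusterInEvent ends x 𝓤B ∩ clusterInEvent ends x 𝓥) -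
          prob (fun e => if e ∈ EB then p e else 0)
              (clusterInEvent ends x {T : Set V | hv ∈ T} ∩ clusterInEvent ends x 𝓤B) *
            prob (fun e => if e ∈ EB then p e else 0) (clusterInEvent ends x 𝓥) -
          prob (fun e => if e ∈ EB then p e else 0)
              (clusterInEvent ends x {T : Set V | hv ∈ T} ∩ clusterInEvent ends x 𝓥) *
            prob (fun e => if e ∈ EB then p e else 0) (clusterInEvent ends x 𝓤B) := by linarith
  have h1 := mul_nonneg hcov hqe
  have h2 := mul_nonneg hξα (add_nonneg (mul_nonneg hξ1 hque) (mul_nonneg hξ0 hTB))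
  linarith [hid, h1, h2]

end TCutVertexOr

end Summit.Ventures.PercRepro2
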